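import Summits.RiemannHypothesis.RiemannHypothesis.Theorems.TiltedLandingLaw421R3SuccSplit

/-! # TiltedLandingLaw421 — round 3q SUPPORT: EXACT NESTING and the THEFT-ONLY residual of `AntiEscape` (W-08, C1 rh-idea-5 g26)

SUPPORT module (proves no stub, no crux; no `sorry`). GLOBAL forms only. Nothing here bears on the truth of RH; RH is not proved.

The open SUCC residual of crux `TiltedLandingLaw421` (stmt-24774) is `RhW08.SuccSplit.AntiEscape` (`…R3SuccSplit`, #1035). This file proves the
EXACT NESTING CRITERION behind C3 g36's memo §3(b) («w ∈ D(v) ⟺ Im K_v(w) < 0») as a kernel lemma over the tree's Jensen-circle apparatus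
(`Literature.Analysis.Complex.exists_logDeriv_eq_sum_pair`, Ki–Kim 2000 §2 / Titchmarsh §3.9 Lemma α), and cuts `AntiEscape` down to its THEFT-ONLY core:

* §1 `im_mul_im_pair_nonpos_of_le` — the conjugate-pair term is `≤ 0` outside the OPEN Jensen disc (non-strict form of the tree's `im_mul_im_pair_nonpos`).
* §2 ★ `norm_sub_re_le_of_unhosted` — real entire `f` of order `< 2`, `f v = 0`, `f′ w = 0`, `f w ≠ 0`, `w` non-real and OUTSIDE THE OPEN JENSEN DISC OF
  EVERY ZERO OTHER THAN `v, v̄` ⇒ `‖w − Re v‖ ≤ |Im v|` (w lies in the CLOSED Jensen disc of `v`): an un-hosted critical point nests under `v`.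
* §3 ★ `nestedStep_of_unhosted`, `stTrkDQ_succ_of_unhosted` — the level-`j` tree form: an upper zero `w` of `f^{(j+1)}` (not a zero of `f^{(j)}`) hosted by
  no other zero pair of `f^{(j)}` is `NestedStep v w`, hence (tree `stTrkDQ_succ_of_nested`) a level-`(j+1)` BAND STATE; `stTrkDQ_succ_of_hostedByBand` —
  a critical point strictly inside the disc of ANY level-`j` band state is a band successor; `stTrkDQ_succ_self_of_multiple` — a multiple band zero is its own successor.
* §4 ★★ the THEFT-ONLY residual `AntiTheft` (OPEN) and `antiEscape_of_antiTheft : AntiTheft → AntiEscape` (PROVED), generic form `AntiTheftG W`,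
  `antiEscapeG_of_antiTheftG : AntiTheftG W → AntiEscapeG W`, and the stub corollaries `restSuccBotQ_of_theft : DimpleSig → AntiTheft → RestSuccBotQ`,
  `restSuccBotQ_of_theftG : WindowCaseSig W → DimpleSig → AntiTheftG W → RestSuccBotQ`.

WHAT REMAINS OPEN (typed, by name): `AntiTheft` — a legal frame, `v` the lowest level-`j` band state, a SIMPLE zero (`f^{(j+1)} v ≠ 0`), level not Ready′,
no all-in-band in-range window at `v`, no dimple at `v`, and EVERY upper zero of `f^{(j+1)}` off the zero set of `f^{(j)}` strictly inside the open Jensen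
disc of an upper zero `a ≠ v` of `f^{(j)}` that is NOT a level-`j` band state («theft by OUT-of-band pairs only») ⇒ the successor level is inhabited.
This is the critic's / C3's THIEF configuration (RESULT-12/14; memo FINAL 4ea02cf8 §3), now with the reduction kernel-checked. -/

namespace RhW08.SuccTheft

open Complex Set
open scoped ComplexConjugate
open Literature.Analysis.Complex
open RhIdea6.G17.W07C7 RhIdea6.G17.W07C7.Rev6 RhIdea6.G18.W07C8.Law421BirthS RhIdea6.G19.W07C11.Seam
open RhIdea6.G20.W07C12.Frac RhIdea6.G20.W07C12.StColP RhW07.C12.FieldSplit RhIdea6.G21.W07C13.TentMax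
open RhW07.C14.TwoSided RhW07.C14.Classes RhW07.C14.Lineage RhW07.C14.Booking
open RhW07.C13.Heredity RhIdea6.G22.W07C15pre.Injection RhW07.E3.Cell RhW07.E3.Lit
open RhW08.Round1 RhW08.StSwap RhW08.Round2 RhW08.QuadW RhW08.SealSwapQ RhW08.SealSwap RhW08.SuccB RhW08.SuccSplit
open Summit.RiemannHypothesis.RiemannHypothesis.Theorems.Splittings.JensenWindow

/-! ## §1 The pair term outside the OPEN disc (non-strict sign) -/

/-- Non-strict sign of the conjugate-pair term: if `|Im a| ≤ ‖z − Re a‖` and `z ≠ a, ā` then `(Im z) · Im (m/(z − a) + m/(z − ā)) ≤ 0`.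
[cite: KiKim2000, §2 p. 50] -/
theorem im_mul_im_pair_nonpos_of_le {a z : ℂ} (h : |a.im| ≤ ‖z - a.re‖) (hza : z ≠ a) (hza' : z ≠ conj a) (m : ℕ) :
    z.im * ((m : ℂ) / (z - a) + (m : ℂ) / (z - conj a)).im ≤ 0 := by
  rw [im_mul_im_div_sub_add_div_sub_conj hza hza' m, neg_nonpos]
  have hsq : a.im ^ 2 ≤ ‖z - a.re‖ ^ 2 := by
    calc a.im ^ 2 = |a.im| ^ 2 := (sq_abs _).symm
      _ ≤ ‖z - a.re‖ ^ 2 := pow_le_pow_left₀ (abs_nonneg _) h 2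
  have : 0 ≤ ‖z - a.re‖ ^ 2 - a.im ^ 2 := sub_nonneg.2 hsq
  positivity

/-! ## §2 EXACT NESTING: an un-hosted critical point lies in the closed Jensen disc of `v` -/

/-- ★ **Exact nesting.** Let `f` be real entire of order `< 2`, `f v = 0`, and let `w` be a non-real zero of `f′` with `f w ≠ 0` lying outside the OPEN
Jensen disc of every zero `a ≠ v, v̄` of `f` (`|Im a| ≤ ‖w − Re a‖`). Then `w` lies in the CLOSED Jensen disc of `v`: `‖w − Re v‖ ≤ |Im v|`.
(Proof: the body of Jensen's circle theorem — in the paired expansion of `f′/f` at `w, w̄` every pair other than `v`'s contributes `≤ 0` to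
`(Im w)·Im`, so `v`'s pair cannot contribute `< 0`.) [cite: KiKim2000, §2 p. 50; Titchmarsh1986, §3.9 Lemma α] -/
theorem norm_sub_re_le_of_unhosted {f : ℂ → ℂ} (hf : Differentiable ℂ f) {ρ C : ℝ} (hρ0 : 0 ≤ ρ) (hρ : ρ < 2)
    (hgr : ∀ z, ‖f z‖ ≤ C * Real.exp (‖z‖ ^ ρ)) (hreal : ∀ x : ℝ, (f x).im = 0)
    {v w : ℂ} (hv : f v = 0) (hfw : deriv f w = 0) (hw : w.im ≠ 0) (hfw0 : f w ≠ 0)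
    (hout : ∀ a, f a = 0 → a ≠ v → a ≠ conj v → |a.im| ≤ ‖w - a.re‖) :
    ‖w - v.re‖ ≤ |v.im| := by
  classical
  by_contra hcon
  push Not at hcon
  have hfw0' : f (conj w) ≠ 0 := by
    rw [apply_conj_eq_conj hf hreal, map_ne_zero]; exact hfw0
  obtain ⟨c, hc⟩ := exists_ofReal_ne_zero hf ⟨w, hfw0⟩
  obtain ⟨-, hκ⟩ := im_mul_im_pair_le hcon hw (le_refl 1)
  set κ : ℝ := 2 * w.im ^ 2 * (‖w - v.re‖ ^ 2 - v.im ^ 2) / (‖w - v‖ ^ 2 * ‖w - conj v‖ ^ 2) with hκdef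
  have hε : 0 < κ / (|w.im| + 1) := by positivity
  obtain ⟨S, m, ψ₁, ψ₂, hS, hS', h1, h2, hψ⟩ :=
    exists_logDeriv_eq_sum_pair hf hρ0 hρ hgr hc hfw0 hfw0' ‖v - c‖ hε
  have hvS : v ∈ S := hS' v hv le_rfl
  have hg1 : deriv f w / f w = 0 := by rw [hfw, zero_div]
  have hg2 : deriv f (conj w) / f (conj w) = 0 := by
    rw [logDeriv_apply_conj hf hreal, hg1, map_zero]
  rw [hg1] at h1
  rw [hg2] at h2
  have h2' : (0 : ℂ) = ∑ a ∈ S, (m a : ℂ) / (w - conj a) + conj ψ₂ := by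
    have := congrArg conj h2
    rw [map_zero, map_add, map_sum] at this
    rw [this]
    congr 1
    refine Finset.sum_congr rfl fun a _ ↦ ?_
    rw [map_div₀, map_natCast, map_sub, Complex.conj_conj]
  have hsum : ∑ a ∈ S, w.im * ((m a : ℂ) / (w - a) + (m a : ℂ) / (w - conj a)).im =
      w.im * (ψ₂.im - ψ₁.im) := by
    have e : ∑ a ∈ S, ((m a : ℂ) / (w - a) + (m a : ℂ) / (w - conj a)) = -(ψ₁ + conj ψ₂) := by
      rw [Finset.sum_add_distrib]
      have e1 : ∑ a ∈ S, (m a : ℂ) / (w - a) = -ψ₁ := eq_neg_of_add_eq_zero_left h1.symm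
      have e2 : ∑ a ∈ S, (m a : ℂ) / (w - conj a) = -conj ψ₂ :=
        eq_neg_of_add_eq_zero_left h2'.symm
      rw [e1, e2]; ring
    rw [← Finset.mul_sum, ← Complex.im_sum, e]
    simp only [Complex.neg_im, Complex.add_im, Complex.conj_im]
    ring
  -- every pair other than `v`'s contributes `≤ 0`; `v`'s pair contributes `≤ -κ < 0`
  have hle : ∑ a ∈ S, w.im * ((m a : ℂ) / (w - a) + (m a : ℂ) / (w - conj a)).im ≤ -κ := by
    rw [← Finset.add_sum_erase S _ hvS]
    have hrest : ∑ a ∈ S.erase v, w.im * ((m a : ℂ) / (w - a) + (m a : ℂ) / (w - conj a)).im ≤ 0 := by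
      refine Finset.sum_nonpos fun a ha ↦ ?_
      have hfa : f a = 0 := (hS a (Finset.mem_of_mem_erase ha)).1
      have hav : a ≠ v := Finset.ne_of_mem_erase ha
      by_cases hac : a = conj v
      · subst hac
        have h' : |(conj v).im| < ‖w - ((conj v).re : ℂ)‖ := by
          simpa [Complex.conj_re, Complex.conj_im, abs_neg] using hcon
        exact im_mul_im_pair_nonpos h' (m (conj v))
      · have hwa : w ≠ a := by
          rintro rfl; exact hfw0 hfa
        have hwa' : w ≠ conj a := by
          rintro rfl
          rw [Complex.conj_conj] at hfw0'
          exact hfw0' hfa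
        exact im_mul_im_pair_nonpos_of_le (hout a hfa hav hac) hwa hwa' (m a)
    have hfirst := (im_mul_im_pair_le hcon hw (hS v hvS).2).1
    rw [← hκdef] at hfirst
    linarith
  have hψim : |ψ₂.im - ψ₁.im| ≤ κ / (|w.im| + 1) := by
    calc |ψ₂.im - ψ₁.im| = |(ψ₁ - ψ₂).im| := by rw [Complex.sub_im, abs_sub_comm]
      _ ≤ ‖ψ₁ - ψ₂‖ := Complex.abs_im_le_norm _
      _ ≤ κ / (|w.im| + 1) := hψ
  have hprod : |w.im * (ψ₂.im - ψ₁.im)| ≤ |w.im| * (κ / (|w.im| + 1)) := by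
    rw [abs_mul]; exact mul_le_mul_of_nonneg_left hψim (abs_nonneg _)
  have hlt : |w.im| * (κ / (|w.im| + 1)) < κ := by
    rw [← mul_div_assoc, div_lt_iff₀ (by positivity)]
    nlinarith [abs_nonneg w.im]
  have := neg_abs_le (w.im * (ψ₂.im - ψ₁.im))
  rw [hsum] at hle
  linarith

/-! ## §3 The level-`j` tree forms -/

/-- The tree's growth format for `f^{(j)}` from a legal frame. -/
theorem exists_growth_levelj {η : ℝ} {f : ℂ → ℂ} {x₀ s hmax R Hs : ℝ} {B : ℕ} (hE : EngineHyps5 2 η f x₀ s hmax R Hs B) (j : ℕ) :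
    ∃ ρ C : ℝ, 0 ≤ ρ ∧ ρ < 2 ∧ ∀ z, ‖iteratedDeriv j f z‖ ≤ C * Real.exp (‖z‖ ^ ρ) := by
  obtain ⟨A', B', ρ, hρ, hgr⟩ := hE.2.2.1
  obtain ⟨τ, C', hτ0, hτ2, _, hgr'⟩ := StubAnalyticHeredity.growth_treeForm hE.1 ⟨A', B', ρ, hρ, hgr⟩
  obtain ⟨ρ', C'', h1, h2, h3⟩ := exists_growth_iteratedDeriv hE.1 hτ0 hτ2 hgr' j
  exact ⟨ρ', C'', h1, h2, h3⟩

/-- ★ **Exact nesting at level `j`.** A level-`j` band state `v`, an upper zero `w` of `f^{(j+1)}` with `f^{(j)} w ≠ 0` outside the open Jensen disc of every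
zero `a ≠ v, v̄` of `f^{(j)}` ⇒ `NestedStep v w`. -/
theorem nestedStep_of_unhosted {η : ℝ} {f : ℂ → ℂ} {x₀ s hmax R Hs : ℝ} {B j : ℕ} {v w : ℂ}
    (hE : EngineHyps5 2 η f x₀ s hmax R Hs B) (hv : StTrkDQ η f x₀ s hmax R Hs B j v)
    (hw0 : iteratedDeriv (j + 1) f w = 0) (hwim : 0 < w.im) (hgw : iteratedDeriv j f w ≠ 0)
    (hout : ∀ a, iteratedDeriv j f a = 0 → a ≠ v → a ≠ conj v → |a.im| ≤ ‖w - a.re‖) :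
    NestedStep v w := by
  obtain ⟨ρ, C, hρ0, hρ, hgr⟩ := exists_growth_levelj hE j
  have hdiff : Differentiable ℂ (iteratedDeriv j f) := differentiable_iteratedDeriv_of_entire hE.1 j
  have hreal : ∀ x : ℝ, (iteratedDeriv j f x).im = 0 := im_iteratedDeriv_ofReal hE.1 hE.2.1 j
  have hfw : deriv (iteratedDeriv j f) w = 0 := by rw [← iteratedDeriv_succ]; exact hw0
  have h := norm_sub_re_le_of_unhosted hdiff hρ0 hρ hgr hreal hv.2.1 hfw hwim.ne' hgw hout
  have e : ‖w - (v.re : ℂ)‖ ^ 2 = (w.re - v.re) ^ 2 + w.im ^ 2 := by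
    rw [← Complex.normSq_eq_norm_sq, Complex.normSq_apply]; simp; ring
  unfold NestedStep
  calc (w.re - v.re) ^ 2 + w.im ^ 2 = ‖w - (v.re : ℂ)‖ ^ 2 := e.symm
    _ ≤ |v.im| ^ 2 := pow_le_pow_left₀ (norm_nonneg _) h 2
    _ = v.im ^ 2 := sq_abs _

/-- ★ An un-hosted upper critical point at level `j` is a level-`(j+1)` BAND STATE. -/
theorem stTrkDQ_succ_of_unhosted {η : ℝ} {f : ℂ → ℂ} {x₀ s hmax R Hs : ℝ} {B j : ℕ} {v w : ℂ}
    (hE : EngineHyps5 2 η f x₀ s hmax R Hs B) (hv : StTrkDQ η f x₀ s hmax R Hs B j v)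
    (hw0 : iteratedDeriv (j + 1) f w = 0) (hwim : 0 < w.im) (hgw : iteratedDeriv j f w ≠ 0)
    (hout : ∀ a, iteratedDeriv j f a = 0 → a ≠ v → a ≠ conj v → |a.im| ≤ ‖w - a.re‖) :
    StTrkDQ η f x₀ s hmax R Hs B (j + 1) w :=
  stTrkDQ_succ_of_nested hE hv hw0 hwim (nestedStep_of_unhosted hE hv hw0 hwim hgw hout)

/-- A multiple band zero is its own successor. -/
theorem stTrkDQ_succ_self_of_multiple {η : ℝ} {f : ℂ → ℂ} {x₀ s hmax R Hs : ℝ} {B j : ℕ} {v : ℂ}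
    (hE : EngineHyps5 2 η f x₀ s hmax R Hs B) (hv : StTrkDQ η f x₀ s hmax R Hs B j v) (hv1 : iteratedDeriv (j + 1) f v = 0) :
    StTrkDQ η f x₀ s hmax R Hs B (j + 1) v :=
  stTrkDQ_succ_of_nested hE hv hv1 hv.2.2.1 (by unfold NestedStep; nlinarith [sq_nonneg (v.re - v.re)])

/-- A critical point STRICTLY inside the Jensen disc of a level-`j` band state `a` is a level-`(j+1)` band state (theft by a BAND pair is harmless). -/
theorem stTrkDQ_succ_of_hostedByBand {η : ℝ} {f : ℂ → ℂ} {x₀ s hmax R Hs : ℝ} {B j : ℕ} {a w : ℂ}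
    (hE : EngineHyps5 2 η f x₀ s hmax R Hs B) (ha : StTrkDQ η f x₀ s hmax R Hs B j a)
    (hw0 : iteratedDeriv (j + 1) f w = 0) (hwim : 0 < w.im) (hin : ‖w - a.re‖ < a.im) :
    StTrkDQ η f x₀ s hmax R Hs B (j + 1) w := by
  refine stTrkDQ_succ_of_nested hE ha hw0 hwim ?_
  have e : ‖w - (a.re : ℂ)‖ ^ 2 = (w.re - a.re) ^ 2 + w.im ^ 2 := by
    rw [← Complex.normSq_eq_norm_sq, Complex.normSq_apply]; simp; ring
  unfold NestedStep
  calc (w.re - a.re) ^ 2 + w.im ^ 2 = ‖w - (a.re : ℂ)‖ ^ 2 := e.symm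
    _ ≤ a.im ^ 2 := pow_le_pow_left₀ (norm_nonneg _) hin.le 2

/-! ## §4 The THEFT-ONLY residual -/

/-- «Every upper critical point is stolen by an OUT-of-band pair»: each upper zero `w` of `f^{(j+1)}` off the zero set of `f^{(j)}` lies STRICTLY inside
the open Jensen disc of an upper zero `a ≠ v` of `f^{(j)}` which is NOT a level-`j` band state. -/
def AllStolen (η : ℝ) (f : ℂ → ℂ) (x₀ s hmax R Hs : ℝ) (B j : ℕ) (v : ℂ) : Prop :=
  ∀ w : ℂ, iteratedDeriv (j + 1) f w = 0 → 0 < w.im → iteratedDeriv j f w ≠ 0 →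
    ∃ a : ℂ, iteratedDeriv j f a = 0 ∧ 0 < a.im ∧ a ≠ v ∧ ‖w - a.re‖ < a.im ∧ ¬ StTrkDQ η f x₀ s hmax R Hs B j a

/-- ★★ ANTI-THEFT (OPEN) — the residual of `AntiEscape` after exact nesting: lowest band state `v` of a non-Ready′ level, `v` a simple zero, no all-in-band
in-range window, no dimple, every upper critical point stolen by an out-of-band pair ⇒ a level-`(j+1)` band state. -/
def AntiTheft : Prop :=
  ∀ (η : ℝ) (f : ℂ → ℂ) (x₀ s hmax R Hs : ℝ) (B : ℕ), EngineHyps5 2 η f x₀ s hmax R Hs B → ∀ (j : ℕ) (v : ℂ),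
    IsLowest StTrkDQ η f x₀ s hmax R Hs B j v → ¬ ReadyR2 η f x₀ s hmax R Hs B j v →
    ¬ AllInBandInRangeWindow f x₀ R Hs j v → ¬ Dimple f j v →
    iteratedDeriv (j + 1) f v ≠ 0 → AllStolen η f x₀ s hmax R Hs B j v →
    ∃ u : ℂ, StTrkDQ η f x₀ s hmax R Hs B (j + 1) u

/-- Generic form over a window predicate `W` (cf. `AntiEscapeG`). -/
def AntiTheftG (W : (ℂ → ℂ) → ℝ → ℝ → ℝ → ℕ → ℂ → Prop) : Prop :=
  ∀ (η : ℝ) (f : ℂ → ℂ) (x₀ s hmax R Hs : ℝ) (B : ℕ), EngineHyps5 2 η f x₀ s hmax R Hs B → ∀ (j : ℕ) (v : ℂ),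
    IsLowest StTrkDQ η f x₀ s hmax R Hs B j v → ¬ ReadyR2 η f x₀ s hmax R Hs B j v →
    ¬ W f x₀ R Hs j v → ¬ Dimple f j v →
    iteratedDeriv (j + 1) f v ≠ 0 → AllStolen η f x₀ s hmax R Hs B j v →
    ∃ u : ℂ, StTrkDQ η f x₀ s hmax R Hs B (j + 1) u

/-- `AntiTheftG AllInBandInRangeWindow` = `AntiTheft`. -/
theorem antiTheftG_allInBand_iff : AntiTheftG AllInBandInRangeWindow ↔ AntiTheft := Iff.rfl

/-- The dichotomy at a band state `v`: either some upper critical point is NOT stolen by an out-of-band pair — and then the successor level is inhabited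
(by `v` itself if multiple, by an un-hosted critical point via exact nesting, or by a band-hosted one) — or `AllStolen` holds with `v` simple. -/
theorem succ_or_allStolen {η : ℝ} {f : ℂ → ℂ} {x₀ s hmax R Hs : ℝ} {B j : ℕ} {v : ℂ}
    (hE : EngineHyps5 2 η f x₀ s hmax R Hs B) (hv : StTrkDQ η f x₀ s hmax R Hs B j v) :
    (∃ u : ℂ, StTrkDQ η f x₀ s hmax R Hs B (j + 1) u) ∨ (iteratedDeriv (j + 1) f v ≠ 0 ∧ AllStolen η f x₀ s hmax R Hs B j v) := by
  classical
  by_cases hv1 : iteratedDeriv (j + 1) f v = 0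
  · exact Or.inl ⟨v, stTrkDQ_succ_self_of_multiple hE hv hv1⟩
  by_cases hall : AllStolen η f x₀ s hmax R Hs B j v
  · exact Or.inr ⟨hv1, hall⟩
  left
  unfold AllStolen at hall
  push Not at hall
  obtain ⟨w, hw0, hwim, hgw, hno⟩ := hall
  -- is `w` strictly inside the disc of some zero `a ≠ v, v̄`?
  by_cases hex : ∃ a : ℂ, iteratedDeriv j f a = 0 ∧ a ≠ v ∧ a ≠ conj v ∧ ‖w - a.re‖ < |a.im|
  · obtain ⟨a, ha, hav, hac, hin⟩ := hex
    have ha0 : a.im ≠ 0 := by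
      intro h0; rw [h0, abs_zero] at hin; exact (not_lt.2 (norm_nonneg _)) hin
    rcases lt_or_gt_of_ne ha0 with hneg | hpos
    · -- use the conjugate `ā` (upper)
      have hreal : ∀ x : ℝ, (iteratedDeriv j f x).im = 0 := im_iteratedDeriv_ofReal hE.1 hE.2.1 j
      have ha' : iteratedDeriv j f (conj a) = 0 := by
        rw [apply_conj_eq_conj (differentiable_iteratedDeriv_of_entire hE.1 j) hreal, ha, map_zero]
      have hpos' : 0 < (conj a).im := by simpa using hneg
      have hav' : conj a ≠ v := by
        intro h; apply hac; rw [← h, Complex.conj_conj]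
      have hin' : ‖w - ((conj a).re : ℂ)‖ < (conj a).im := by
        rw [Complex.conj_re, Complex.conj_im, ← abs_of_neg hneg]; exact hin
      have hband : StTrkDQ η f x₀ s hmax R Hs B j (conj a) := hno (conj a) ha' hpos' hav' hin'
      exact ⟨w, stTrkDQ_succ_of_hostedByBand hE hband hw0 hwim hin'⟩
    · have hin' : ‖w - (a.re : ℂ)‖ < a.im := by rw [← abs_of_pos hpos]; exact hin
      have hband : StTrkDQ η f x₀ s hmax R Hs B j a := hno a ha hpos hav hin'
      exact ⟨w, stTrkDQ_succ_of_hostedByBand hE hband hw0 hwim hin'⟩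
  · push Not at hex
    exact ⟨w, stTrkDQ_succ_of_unhosted hE hv hw0 hwim hgw fun a ha hav hac => hex a ha hav hac⟩

/-- ★★ `AntiEscapeG W` ⟸ `AntiTheftG W`: the anti-escape residual is THEFT-ONLY. -/
theorem antiEscapeG_of_antiTheftG {W : (ℂ → ℂ) → ℝ → ℝ → ℝ → ℕ → ℂ → Prop} (h : AntiTheftG W) : AntiEscapeG W := by
  intro η f x₀ s hmax R Hs B hE j v hlow hnr hw hdim
  rcases succ_or_allStolen hE hlow.1 with hsucc | ⟨hv1, hall⟩
  · exact hsucc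
  · exact h η f x₀ s hmax R Hs B hE j v hlow hnr hw hdim hv1 hall

/-- ★★ `AntiEscape` ⟸ `AntiTheft`. -/
theorem antiEscape_of_antiTheft (h : AntiTheft) : AntiEscape :=
  (antiEscapeG_allInBand_iff).1 (antiEscapeG_of_antiTheftG ((antiTheftG_allInBand_iff).2 h))

/-- STUB 1 ⟸ the dimple lemma + ANTI-THEFT. -/
theorem restSuccBotQ_of_theft (hD : DimpleSig) (hT : AntiTheft) : RestSuccBotQ :=
  restSuccBotQ_of_pieces hD (antiEscape_of_antiTheft hT)

/-- STUB 1 ⟸ any window-case lemma + the dimple lemma + the matching ANTI-THEFT residual. -/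
theorem restSuccBotQ_of_theftG {W : (ℂ → ℂ) → ℝ → ℝ → ℝ → ℕ → ℂ → Prop}
    (hW : WindowCaseSig W) (hD : DimpleSig) (hT : AntiTheftG W) : RestSuccBotQ :=
  restSuccBotQ_of_piecesG hW hD (antiEscapeG_of_antiTheftG hT)

end RhW08.SuccTheft
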